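import Summits.RiemannHypothesis.RiemannHypothesis.Theorems.WeilParityOffLineParityDetectionLocProfile
import Summits.RiemannHypothesis.RiemannHypothesis.Theorems.WeilParityOffLineParityDetectionLocLayerBounds
import HarnessLib

/-!
# The even floor on the top layer (helper file for stub LOC)

Route `WeilParity`, crux `OffLineParityDetection` (item stmt-RiemannHypothesis-15431), line
`registered`, stub `stub_finiteDefectLocalisation` (LOC).  Pure real analysis, no zeta facts and
no definitions.  Fix `η₀ > 0`, a finite set `T` of points with `Re ρ = 1/2 + η₀`, weights `w ≥ 0`
on `T`, a half-width `a ≥ 1`, and a DANGER BOUND `D ≥ 0` for the mirror-pairing form at `a`: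
`-gain(a, f) ≤ D ∫₀^∞ f²` for every smooth compactly supported real profile `f` on `[0, ∞)`, where
`gain(a, f) = Σ_T w(ρ) Re(e^{2i(Im ρ)a} F_f(ρ - 1/2)²)`, `F_f(z) = ∫₀^∞ f(u) e^{-zu} du`.  Then for
every real-valued even Weil test `e` on `[-a, a]` with `∫ |e|² = 1`,

  `Σ_T w(ρ) Re ê(ρ)² ≥ -(D/2) e^{2η₀a} - 3 K₁² e^{η₀} (Σ_T w) e^{η₀a}`,  `K₁ = (1 + 1/η₀)/2`

(`loc_evenTop`).  Mechanism: with the profile `p(u) = Re e(a - u)` (`∫₀^∞ p² = 1`,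
`∫_{(0,a]} p² ≤ 1/2`, `loc_evenProfile`) one has `ê(ρ) = e^{(ρ-1/2)a} F_p(ρ - 1/2)` for every `ρ`,
so `Σ_T w Re ê² = e^{2η₀a} gain(a, p)`; the smooth cutoff `p = g + h` (`loc_cutoff`) has
`∫₀^∞ g² ≤ 1/2`, hence `gain(a, g) ≥ -D/2`, while `‖F_g‖ ≤ K₁` and `‖F_h‖ ≤ e^{-η₀(a-1)} K₁`
(`loc_norm_lap_le`, `h = 0` on `(-∞, a-1]`), so `gain(a, p) ≥ gain(a, g) - 3K₁² e^{-η₀(a-1)} Σ_T w`.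
-/

set_option linter.dupNamespace false

noncomputable section

namespace Summit.RiemannHypothesis.RiemannHypothesis.Theorems.WeilParityOffLineParityDetection

open MeasureTheory Set Filter
open scoped ComplexConjugate
open Literature.NumberTheory.LFunctions

/-- `|Re (c (X² - Y²))| ≤ ‖X - Y‖ (2‖Y‖ + ‖X - Y‖)` for `‖c‖ ≤ 1`. [folklore] -/
theorem loc_re_mul_sq_sub_sq_ge {c X Y : ℂ} (hc : ‖c‖ ≤ 1) :
    (c * Y ^ 2).re - ‖X - Y‖ * (2 * ‖Y‖ + ‖X - Y‖) ≤ (c * X ^ 2).re := by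
  have h1 : c * X ^ 2 = c * Y ^ 2 + c * ((X - Y) * (2 * Y + (X - Y))) := by ring
  have h2 : |(c * ((X - Y) * (2 * Y + (X - Y)))).re| ≤ ‖c * ((X - Y) * (2 * Y + (X - Y)))‖ :=
    Complex.abs_re_le_norm _
  have h3 : ‖c * ((X - Y) * (2 * Y + (X - Y)))‖ ≤ ‖X - Y‖ * (2 * ‖Y‖ + ‖X - Y‖) := by
    rw [norm_mul, norm_mul]
    have h4 : ‖2 * Y + (X - Y)‖ ≤ 2 * ‖Y‖ + ‖X - Y‖ := by
      calc ‖2 * Y + (X - Y)‖ ≤ ‖2 * Y‖ + ‖X - Y‖ := norm_add_le _ _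
        _ = 2 * ‖Y‖ + ‖X - Y‖ := by rw [norm_mul, Complex.norm_ofNat]
    have h5 : ‖X - Y‖ * ‖2 * Y + (X - Y)‖ ≤ ‖X - Y‖ * (2 * ‖Y‖ + ‖X - Y‖) :=
      mul_le_mul_of_nonneg_left h4 (norm_nonneg _)
    have h6 : 0 ≤ ‖X - Y‖ * ‖2 * Y + (X - Y)‖ := by positivity
    nlinarith [norm_nonneg c]
  rw [h1, Complex.add_re]
  linarith [(abs_le.1 h2).1]

/-- The phase factor `e^{2i(Im ρ)a}` is unimodular. [folklore] -/
theorem loc_norm_phase (ρ : ℂ) (a : ℝ) :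
    ‖Complex.exp (2 * (ρ.im : ℂ) * (a : ℂ) * Complex.I)‖ = 1 := by
  rw [Complex.norm_exp]
  simp

/-- **The even floor on the top layer** (registered sub-goal of the item, closed form); see the
module docstring. [folklore] -/
theorem loc_evenTop :
    ∀ (η₀ : ℝ), 0 < η₀ → ∀ (T : Finset ℂ), (∀ ρ ∈ T, ρ.re = 1 / 2 + η₀) →
      ∀ (w : ℂ → ℝ), (∀ ρ ∈ T, 0 ≤ w ρ) → ∀ (a D : ℝ), 1 ≤ a → 0 ≤ D →
      (∀ f : ℝ → ℝ, ContDiff ℝ (⊤ : ℕ∞) f → HasCompactSupport f → tsupport f ⊆ Set.Ici 0 →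
        -(∑ ρ ∈ T, w ρ * (Complex.exp (2 * (ρ.im : ℂ) * (a : ℂ) * Complex.I) *
            (∫ u in Set.Ioi (0 : ℝ), (f u : ℂ) * Complex.exp (-((ρ - 1 / 2) * (u : ℂ)))) ^ 2).re)
          ≤ D * ∫ u in Set.Ioi (0 : ℝ), f u ^ 2) →
      ∀ (e : ℝ → ℂ), IsWeilTest e → tsupport e ⊆ Set.Icc (-a) a → (∀ t, e (-t) = e t) →
        (∀ t, (e t).im = 0) → ∫ t, ‖e t‖ ^ 2 = (1 : ℝ) →
        -(D / 2) * Real.exp (2 * η₀ * a) -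
            3 * ((1 + 1 / η₀) / 2) ^ 2 * Real.exp η₀ * (∑ ρ ∈ T, w ρ) * Real.exp (η₀ * a) ≤
          ∑ ρ ∈ T, w ρ * ((weilMellin e ρ) ^ 2).re := by
  intro η₀ hη₀ T hTre w hw a D ha hD hdanger e he hsupp heven hreal hnorm
  have ha0 : 0 ≤ a := by linarith
  -- the profile `p` and its cutoff `p = g + h`
  obtain ⟨p, hp⟩ : ∃ p : ℝ → ℝ, ∀ u, p u = (e (a - u)).re := ⟨_, fun u ↦ rfl⟩
  obtain ⟨hps, hpc, -, hp0, hep, hp1, hphalf⟩ :=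
    loc_evenProfile a e ha0 he hsupp heven hreal hnorm p hp
  obtain ⟨g, hg⟩ : ∃ g : ℝ → ℝ, ∀ u, g u = Real.smoothTransition (a - u) * p u :=
    ⟨_, fun u ↦ rfl⟩
  obtain ⟨h, hh⟩ : ∃ h : ℝ → ℝ, ∀ u, h u = (1 - Real.smoothTransition (a - u)) * p u :=
    ⟨_, fun u ↦ rfl⟩
  obtain ⟨hgs, hgc, hgsupp, hhc', hhc, hh0, hpgh, hgint, hhint⟩ := loc_cutoff hps hpc hp0 a hg hh
  have hg0 : ∀ u ≤ 0, g u = 0 := fun u hu ↦ by rw [hg, hp0 u hu, mul_zero]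
  have hh0' : ∀ u ≤ a - 1, h u = 0 := hh0
  -- the three Laplace integrals (kept opaque)
  obtain ⟨Fp, hFp⟩ : ∃ Fp : ℂ → ℂ, ∀ ρ, Fp ρ =
      ∫ u in Ioi (0 : ℝ), (p u : ℂ) * Complex.exp (-((ρ - 1 / 2) * (u : ℂ))) := ⟨_, fun _ ↦ rfl⟩
  obtain ⟨Fg, hFg⟩ : ∃ Fg : ℂ → ℂ, ∀ ρ, Fg ρ =
      ∫ u in Ioi (0 : ℝ), (g u : ℂ) * Complex.exp (-((ρ - 1 / 2) * (u : ℂ))) := ⟨_, fun _ ↦ rfl⟩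
  obtain ⟨Fh, hFh⟩ : ∃ Fh : ℂ → ℂ, ∀ ρ, Fh ρ =
      ∫ u in Ioi (0 : ℝ), (h u : ℂ) * Complex.exp (-((ρ - 1 / 2) * (u : ℂ))) := ⟨_, fun _ ↦ rfl⟩
  have hFsum : ∀ ρ, Fp ρ = Fg ρ + Fh ρ := fun ρ ↦ by
    rw [hFp, hFg, hFh, ← loc_lap_add hgs.continuous hgc hhc' hhc]
    refine setIntegral_congr_fun measurableSet_Ioi fun u _ ↦ ?_
    rw [hpgh u]
  -- sizes on the top layer
  set K₁ : ℝ := (1 + 1 / η₀) / 2 with hK₁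
  set ε : ℝ := Real.exp (-(η₀ * (a - 1))) with hε
  have hK₁0 : 0 ≤ K₁ := by positivity
  have hε0 : 0 ≤ ε := (Real.exp_pos _).le
  have hε1 : ε ≤ 1 := Real.exp_le_one_iff.2 (by nlinarith)
  have hre : ∀ ρ ∈ T, (ρ - 1 / 2).re = η₀ := fun ρ hρ ↦ by simp [hTre ρ hρ]
  have hFgle : ∀ ρ ∈ T, ‖Fg ρ‖ ≤ K₁ := fun ρ hρ ↦ by
    have h1 := loc_norm_lap_le g hgs.continuous hgc 0 le_rfl hg0 (ρ - 1 / 2)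
      (by rw [hre ρ hρ]; exact hη₀)
    rw [← hFg, hre ρ hρ, mul_zero, neg_zero, Real.exp_zero, one_mul] at h1
    have h2 : ∫ u in Ioi (0 : ℝ), g u ^ 2 ≤ 1 := by linarith
    calc ‖Fg ρ‖ ≤ ((∫ u in Ioi (0 : ℝ), g u ^ 2) + 1 / η₀) / 2 := h1
      _ ≤ K₁ := by rw [hK₁]; linarith
  have hFhle : ∀ ρ ∈ T, ‖Fh ρ‖ ≤ ε * K₁ := fun ρ hρ ↦ by
    have h1 := loc_norm_lap_le h hhc' hhc (a - 1) (by linarith) hh0' (ρ - 1 / 2)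
      (by rw [hre ρ hρ]; exact hη₀)
    rw [← hFh, hre ρ hρ] at h1
    have h2 : ∫ u in Ioi (0 : ℝ), h u ^ 2 ≤ 1 := by linarith
    calc ‖Fh ρ‖ ≤ Real.exp (-(η₀ * (a - 1))) * ((∫ u in Ioi (0 : ℝ), h u ^ 2) + 1 / η₀) / 2 := h1
      _ = ε * (((∫ u in Ioi (0 : ℝ), h u ^ 2) + 1 / η₀) / 2) := by rw [hε]; ring
      _ ≤ ε * K₁ := by
          refine mul_le_mul_of_nonneg_left ?_ hε0
          rw [hK₁]
          linarith
  -- the gain of `p` versus the gain of `g`, one point at a time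
  have hpt : ∀ ρ ∈ T,
      w ρ * (Complex.exp (2 * (ρ.im : ℂ) * (a : ℂ) * Complex.I) * Fg ρ ^ 2).re -
          w ρ * (3 * K₁ ^ 2 * ε) ≤
        w ρ * (Complex.exp (2 * (ρ.im : ℂ) * (a : ℂ) * Complex.I) * Fp ρ ^ 2).re := by
    intro ρ hρ
    have h1 := loc_re_mul_sq_sub_sq_ge (c := Complex.exp (2 * (ρ.im : ℂ) * (a : ℂ) * Complex.I))
      (X := Fp ρ) (Y := Fg ρ) (le_of_eq (loc_norm_phase ρ a))
    have hXY : Fp ρ - Fg ρ = Fh ρ := by rw [hFsum ρ]; ring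
    rw [hXY] at h1
    have h2 : ‖Fh ρ‖ * (2 * ‖Fg ρ‖ + ‖Fh ρ‖) ≤ 3 * K₁ ^ 2 * ε := by
      have hb1 := hFhle ρ hρ
      have hb2 := hFgle ρ hρ
      calc ‖Fh ρ‖ * (2 * ‖Fg ρ‖ + ‖Fh ρ‖) ≤ (ε * K₁) * (2 * K₁ + ε * K₁) :=
            mul_le_mul hb1 (by linarith) (by positivity) (by positivity)
        _ ≤ (ε * K₁) * (2 * K₁ + 1 * K₁) := by
            refine mul_le_mul_of_nonneg_left ?_ (by positivity)
            nlinarith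
        _ = 3 * K₁ ^ 2 * ε := by ring
    have hw' := hw ρ hρ
    nlinarith
  -- summing: `gain(p) ≥ gain(g) - 3 K₁² ε Σ w ≥ -D/2 - 3 K₁² ε Σ w`
  have hgainle : -(D / 2) - 3 * K₁ ^ 2 * ε * ∑ ρ ∈ T, w ρ ≤
      ∑ ρ ∈ T, w ρ * (Complex.exp (2 * (ρ.im : ℂ) * (a : ℂ) * Complex.I) * Fp ρ ^ 2).re := by
    have h1 : ∑ ρ ∈ T, (w ρ * (Complex.exp (2 * (ρ.im : ℂ) * (a : ℂ) * Complex.I) * Fg ρ ^ 2).re -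
        w ρ * (3 * K₁ ^ 2 * ε)) ≤
        ∑ ρ ∈ T, w ρ * (Complex.exp (2 * (ρ.im : ℂ) * (a : ℂ) * Complex.I) * Fp ρ ^ 2).re :=
      Finset.sum_le_sum hpt
    rw [Finset.sum_sub_distrib, ← Finset.sum_mul] at h1
    have h2 := hdanger g hgs hgc hgsupp
    simp_rw [← hFg] at h2
    have h3 : D * ∫ u in Ioi (0 : ℝ), g u ^ 2 ≤ D / 2 := by
      have := mul_le_mul_of_nonneg_left (hgint.trans hphalf) hD
      linarith
    linarith
  -- the top identity `ê(ρ) = e^{(ρ-1/2)a} F_p(ρ - 1/2)` and `Re ê² = e^{2η₀a} Re (phase · F_p²)`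
  have hef : e = fun t ↦ ((p (a - t) : ℝ) : ℂ) := funext hep
  have hê : ∀ ρ, weilMellin e ρ = Complex.exp ((ρ - 1 / 2) * (a : ℂ)) * Fp ρ := fun ρ ↦ by
    rw [hef, loc_weilMellin_reflect p hp0 a ρ, hFp]
  have hsumT : ∑ ρ ∈ T, w ρ * ((weilMellin e ρ) ^ 2).re = Real.exp (2 * η₀ * a) *
      ∑ ρ ∈ T, w ρ * (Complex.exp (2 * (ρ.im : ℂ) * (a : ℂ) * Complex.I) * Fp ρ ^ 2).re := by
    rw [Finset.mul_sum]
    refine Finset.sum_congr rfl fun ρ hρ ↦ ?_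
    rw [hê ρ, loc_re_sq_top (hTre ρ hρ) a (Fp ρ)]
    ring
  rw [hsumT]
  have hexp : Real.exp (2 * η₀ * a) * ε = Real.exp η₀ * Real.exp (η₀ * a) := by
    rw [hε, ← Real.exp_add, ← Real.exp_add]
    congr 1
    ring
  have hE0 : 0 < Real.exp (2 * η₀ * a) := Real.exp_pos _
  have key := mul_le_mul_of_nonneg_left hgainle hE0.le
  have hrw : Real.exp (2 * η₀ * a) * (-(D / 2) - 3 * K₁ ^ 2 * ε * ∑ ρ ∈ T, w ρ) =
      -(D / 2) * Real.exp (2 * η₀ * a) -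
        3 * K₁ ^ 2 * Real.exp η₀ * (∑ ρ ∈ T, w ρ) * Real.exp (η₀ * a) := by
    have : Real.exp (2 * η₀ * a) * (3 * K₁ ^ 2 * ε * ∑ ρ ∈ T, w ρ) =
        3 * K₁ ^ 2 * (Real.exp (2 * η₀ * a) * ε) * ∑ ρ ∈ T, w ρ := by ring
    rw [mul_sub, this, hexp]
    ring
  rw [hrw] at key
  exact key

end Summit.RiemannHypothesis.RiemannHypothesis.Theorems.WeilParityOffLineParityDetection

end
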